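/-
Copyright (c) 2026. All rights reserved.
Released under Apache 2.0 license as described in the file LICENSE.
Authors: abc-iut cell, seat abc-iut-w6-d102 (gen 2).
-/
import Literature.GroupTheory.StronglyCompleteSolvableDescent
import Literature.GroupTheory.StronglyCompleteAbelianByAbelian
import Literature.GroupTheory.ProPStronglyComplete
import HarnessLib

/-!
# Strong completeness by solvable descent — the hypothesis (H1) from closed commutator subgroups

Companion (PROOF-ONLY) to `Literature/GroupTheory/StronglyCompleteSolvableDescent.lean`.  There,
strong completeness («every finite-index subgroup is open») of a topological group all of whose
abstract finite normal quotients are solvable is reduced to (H1): every subgroup of PRIME index,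
normal in an OPEN subgroup `U`, is open.  Here (H1) is derived for a profinite group `G` topologically
generated by a finite set from the hypothesis that the commutator subgroup `⁅U, U⁆` of every open
subgroup `U` is CLOSED: `U` is again topologically finitely generated (Schreier,
`exists_finset_dense_closure_of_isOpen`), `U ⧸ ⁅U, U⁆` is then a topologically finitely generated
abelian profinite group, whose finite-index subgroups are open
(`StronglyCompleteAbelianByAbelian.isOpen_of_finiteIndex_quotient_of_commutator_mem`), and a
prime-index normal subgroup contains the commutator subgroup.  This is the skeleton of Hartley's
theorem (finitely generated profinite groups of bounded Fitting height are strongly complete), where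
the closedness of `⁅U, U⁆` comes from a uniform bound on the commutator width of the finite quotients;
that bound is NOT proved here.

* `isOpen_of_commutator_le_of_commutator_isClosed` — finite-index `M ≤ U` above a closed `⁅U, U⁆` is open;
* `primeIndex_isOpen_of_commutator_isClosed` — (H1);
* `isOpen_of_finiteIndex_of_commutator_isClosed` — closed commutators of open subgroups + solvable
  abstract finite quotients ⟹ every finite-index subgroup is open;
* `isClosed_commutator_of_isClosed_commutator_subtype` and the primed forms — the same with the
  intrinsic spelling «`commutator ↥U` closed in `↥U`», e.g. for the RHS of the abc-iut reduction
  `MLFGaloisTameStronglyComplete.forall_finiteIndex_isOpen_iff_index_p`.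

Intended use (abc-iut, GAP row G-L3d2g2-1 / F-1977 at `Γ_K`, `K` a `p`-adic local field): the
commutator-width route.  Nothing here bears on [IUTchIII] Cor. 3.12.

[cite: DDMSAnalyticProP1999, Thm 1.17 and Prop 1.19]
-/

namespace Literature.GroupTheory

namespace StronglyCompleteSolvableDescent

open Topology
open scoped commutatorElement

universe u

variable {G : Type u} [Group G] [TopologicalSpace G]

/-- Transport of openness from an open subgroup `U` to a subgroup `M ≤ U` open in `↥U`. [folklore] -/
private theorem isOpen_of_isOpen_subgroupOf' {U M : Subgroup G} (hU : IsOpen (U : Set G))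
    (hMU : M ≤ U) (hM : IsOpen ((M.subgroupOf U : Subgroup U) : Set U)) : IsOpen (M : Set G) := by
  have himg : IsOpen (((↑) : U → G) '' ((M.subgroupOf U : Subgroup U) : Set U)) :=
    hU.isOpenMap_subtype_val _ hM
  have hset : ((↑) : U → G) '' ((M.subgroupOf U : Subgroup U) : Set U) = (M : Set G) := by
    ext x
    constructor
    · rintro ⟨y, hy, rfl⟩
      exact Subgroup.mem_subgroupOf.mp hy
    · intro hx
      exact ⟨⟨x, hMU hx⟩, Subgroup.mem_subgroupOf.mpr hx, rfl⟩
  rw [hset] at himg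
  exact himg

/-! ## (H1) from closed commutator subgroups (topologically finitely generated profinite groups) -/

section Commutator

variable [IsTopologicalGroup G] [CompactSpace G] [TotallyDisconnectedSpace G]

/-- **Prime-index (indeed all abelian finite-index) normal subgroups of open subgroups are open when
commutator subgroups are closed.** Let `G` be a profinite group topologically generated by a finite
set, `U` an open subgroup whose commutator subgroup `⁅U, U⁆` is CLOSED in `G`, and `M ≤ U` a subgroup
of finite index in `U` containing `⁅U, U⁆`.  Then `M` is open: `U` is topologically finitely generated
(Schreier, `exists_finset_dense_closure_of_isOpen`), so `U ⧸ ⁅U, U⁆` is a topologically finitely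
generated abelian profinite group, in which finite-index subgroups are open
(`isOpen_of_finiteIndex_quotient_of_commutator_mem`) — the step «`[G,G]` closed ⟹ `G^p[G,G]` closed
of finite index ⟹ open» of Serre's theorem. [cite: DDMSAnalyticProP1999, Thm 1.17 (proof)] -/
theorem isOpen_of_commutator_le_of_commutator_isClosed
    (hS : ∃ S : Finset G, Dense ((Subgroup.closure (S : Set G) : Subgroup G) : Set G))
    {U M : Subgroup G} (hU : IsOpen (U : Set G)) (hUc : IsClosed ((⁅U, U⁆ : Subgroup G) : Set G))
    (hMU : M ≤ U) (hCM : ⁅U, U⁆ ≤ M) (hMi : M.relIndex U ≠ 0) : IsOpen (M : Set G) := by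
  classical
  -- `U` as a profinite group, topologically finitely generated
  have hUcl : IsClosed (U : Set G) := Subgroup.isClosed_of_isOpen U hU
  haveI : CompactSpace U := isCompact_iff_compactSpace.mp hUcl.isCompact
  have hSU := exists_finset_dense_closure_of_isOpen hS U hU
  -- its commutator subgroup `C`, closed
  set C : Subgroup U := ⁅(⊤ : Subgroup U), ⊤⁆ with hC
  haveI : C.Normal := Subgroup.commutator_normal ⊤ ⊤
  have hCmap : C.map U.subtype = ⁅U, U⁆ := by
    rw [hC, Subgroup.map_commutator, ← MonoidHom.range_eq_map, Subgroup.range_subtype]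
  have hCset : (C : Set U) = ((↑) : U → G) ⁻¹' ((⁅U, U⁆ : Subgroup G) : Set G) := by
    rw [← hCmap]
    ext x
    simp only [SetLike.mem_coe, Set.mem_preimage]
    constructor
    · intro hx
      exact ⟨x, hx, rfl⟩
    · rintro ⟨y, hy, hyx⟩
      rwa [← U.subtype_injective hyx]
  have hCc : IsClosed (C : Set U) := by
    rw [hCset]
    exact hUc.preimage continuous_subtype_val
  have hGC : ∀ x y : U, x * y * x⁻¹ * y⁻¹ ∈ C := by
    intro x y
    rw [← commutatorElement_def]
    exact Subgroup.commutator_mem_commutator (Subgroup.mem_top x) (Subgroup.mem_top y)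
  -- finite-index subgroups of `U` above `C` are open in `U`
  have hsub := (StronglyCompleteAbelianByAbelian.forall_isOpen_of_finiteIndex_of_le_iff_quotient
    C).mpr (fun W hW => by
      haveI := hW
      exact StronglyCompleteAbelianByAbelian.isOpen_of_finiteIndex_quotient_of_commutator_mem C
        hCc hGC hSU W)
  haveI : (M.subgroupOf U).FiniteIndex := ⟨hMi⟩
  have hCM' : C ≤ M.subgroupOf U := by
    rw [hC, Subgroup.commutator_le]
    intro x _ y _
    refine Subgroup.mem_subgroupOf.mpr (hCM ?_)
    rw [commutatorElement_def]
    have : ((x * y * x⁻¹ * y⁻¹ : U) : G) = ⁅(x : G), (y : G)⁆ := by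
      rw [commutatorElement_def]; simp
    rw [this]
    exact Subgroup.commutator_mem_commutator x.2 y.2
  exact isOpen_of_isOpen_subgroupOf' hU hMU (hsub _ inferInstance hCM')

/-- **(H1) from closed commutators.** `G` profinite topologically finitely generated, `⁅U, U⁆` closed
for every open subgroup `U`: then every subgroup `M ≤ U` normal in `U` of prime index is open (the
quotient is cyclic, hence abelian, so `⁅U, U⁆ ≤ M`). [cite: DDMSAnalyticProP1999, Thm 1.17 (proof)] -/
theorem primeIndex_isOpen_of_commutator_isClosed
    (hS : ∃ S : Finset G, Dense ((Subgroup.closure (S : Set G) : Subgroup G) : Set G))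
    (hA : ∀ U : Subgroup G, IsOpen (U : Set G) → IsClosed ((⁅U, U⁆ : Subgroup G) : Set G))
    (U M : Subgroup G) (hU : IsOpen (U : Set G)) (hMU : M ≤ U) (hMn : (M.subgroupOf U).Normal)
    (hMp : (M.relIndex U).Prime) : IsOpen (M : Set G) := by
  classical
  haveI := hMn
  -- the quotient has prime order, hence is cyclic and commutative
  haveI : Fact (M.relIndex U).Prime := ⟨hMp⟩
  haveI : (M.subgroupOf U).FiniteIndex := ⟨hMp.ne_zero⟩
  haveI : Finite (U ⧸ M.subgroupOf U) := Subgroup.finite_quotient_of_finiteIndex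
  have hcyc : IsCyclic (U ⧸ M.subgroupOf U) :=
    isCyclic_of_prime_card (p := M.relIndex U) (by rw [← Subgroup.index]; rfl)
  have hcomm : ∀ a b : U ⧸ M.subgroupOf U, a * b = b * a := by
    letI := hcyc.commGroup
    exact fun a b => mul_comm a b
  have hCM : ⁅U, U⁆ ≤ M := by
    rw [Subgroup.commutator_le]
    intro x hx y hy
    have h1 : (QuotientGroup.mk (s := M.subgroupOf U)
        ((⟨x, hx⟩ : U) * ⟨y, hy⟩ * (⟨x, hx⟩ : U)⁻¹ * (⟨y, hy⟩ : U)⁻¹) : U ⧸ M.subgroupOf U) = 1 := by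
      rw [QuotientGroup.mk_mul, QuotientGroup.mk_mul, QuotientGroup.mk_mul, QuotientGroup.mk_inv,
        QuotientGroup.mk_inv, hcomm (QuotientGroup.mk (⟨x, hx⟩ : U)) (QuotientGroup.mk ⟨y, hy⟩),
        mul_inv_cancel_right, mul_inv_cancel]
    have hmem := Subgroup.mem_subgroupOf.mp ((QuotientGroup.eq_one_iff _).mp h1)
    rw [commutatorElement_def]
    simpa using hmem
  exact isOpen_of_commutator_le_of_commutator_isClosed hS hU (hA U hU) hMU hCM hMp.ne_zero

/-- **Strong completeness from closed commutator subgroups and solvable finite quotients.** Let `G` be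
a profinite group topologically generated by a finite set such that `⁅U, U⁆` is closed for every open
subgroup `U` and `G ⧸ N` is solvable for every normal finite-index `N`.  Then every finite-index
subgroup of `G` is open.  (Hartley's route for groups of bounded Fitting height: the closedness comes
from a uniform commutator width in the finite quotients, as `[G,G]` closed does in Serre's theorem via
Prop. 1.19 of Dixon–du Sautoy–Mann–Segal.) [cite: DDMSAnalyticProP1999, Thm 1.17] -/
theorem isOpen_of_finiteIndex_of_commutator_isClosed
    (hS : ∃ S : Finset G, Dense ((Subgroup.closure (S : Set G) : Subgroup G) : Set G))
    (hA : ∀ U : Subgroup G, IsOpen (U : Set G) → IsClosed ((⁅U, U⁆ : Subgroup G) : Set G))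
    (hsolv : ∀ (N : Subgroup G) [N.Normal] [N.FiniteIndex], IsSolvable (G ⧸ N))
    (H : Subgroup G) [H.FiniteIndex] : IsOpen (H : Set G) :=
  isOpen_of_finiteIndex_of_primeIndex_descent (primeIndex_isOpen_of_commutator_isClosed hS hA)
    hsolv H

omit [CompactSpace G] [TotallyDisconnectedSpace G] in
/-- Bridge between the two spellings of «the commutator subgroup of `U` is closed»: if `U` is an open
subgroup of `G` and the commutator subgroup of the GROUP `↥U` is closed in `↥U`, then `⁅U, U⁆` is
closed in `G` (`⁅U, U⁆` is the image of `commutator ↥U` under the closed embedding `↥U → G`).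
[cite: DDMSAnalyticProP1999, Prop 1.19] -/
theorem isClosed_commutator_of_isClosed_commutator_subtype {U : Subgroup G} (hU : IsOpen (U : Set G))
    (hc : IsClosed ((commutator U : Subgroup U) : Set U)) :
    IsClosed ((⁅U, U⁆ : Subgroup G) : Set G) := by
  have hUcl : IsClosed (U : Set G) := Subgroup.isClosed_of_isOpen U hU
  have hmap : (commutator U).map U.subtype = ⁅U, U⁆ := by
    rw [commutator_def, Subgroup.map_commutator, ← MonoidHom.range_eq_map, Subgroup.range_subtype]
  rw [← hmap, Subgroup.coe_map]
  exact (hUcl.isClosedEmbedding_subtypeVal.isClosedMap) _ hc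

/-- **Strong completeness from closed commutator subgroups, intrinsic spelling**: as
`isOpen_of_finiteIndex_of_commutator_isClosed`, with the hypothesis «`commutator ↥U` is closed in the
group `↥U`» for every open subgroup `U` (the output shape of a uniform commutator-width bound in the
finite quotients of `↥U`). [cite: DDMSAnalyticProP1999, Thm 1.17] -/
theorem isOpen_of_finiteIndex_of_commutator_isClosed'
    (hS : ∃ S : Finset G, Dense ((Subgroup.closure (S : Set G) : Subgroup G) : Set G))
    (hA : ∀ U : Subgroup G, IsOpen (U : Set G) → IsClosed ((commutator U : Subgroup U) : Set U))
    (hsolv : ∀ (N : Subgroup G) [N.Normal] [N.FiniteIndex], IsSolvable (G ⧸ N))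
    (H : Subgroup G) [H.FiniteIndex] : IsOpen (H : Set G) :=
  isOpen_of_finiteIndex_of_commutator_isClosed hS
    (fun U hU => isClosed_commutator_of_isClosed_commutator_subtype hU (hA U hU)) hsolv H

/-- **Prime-index normal subgroups of open subgroups are open, intrinsic spelling** — the form in which
the abc-iut reduction `MLFGaloisTameStronglyComplete.forall_finiteIndex_isOpen_iff_index_p` (RHS:
every `V₁ ≤ V`, normal in the open `V`, of index `p`) consumes a closed-commutator input: `G` profinite
topologically finitely generated, `commutator ↥V` closed in `↥V` for every open `V`.
[cite: DDMSAnalyticProP1999, Thm 1.17 (proof)] -/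
theorem primeIndex_isOpen_of_commutator_isClosed'
    (hS : ∃ S : Finset G, Dense ((Subgroup.closure (S : Set G) : Subgroup G) : Set G))
    (hA : ∀ U : Subgroup G, IsOpen (U : Set G) → IsClosed ((commutator U : Subgroup U) : Set U))
    (V V₁ : Subgroup G) (hV : IsOpen (V : Set G)) (hV₁V : V₁ ≤ V) (hn : (V₁.subgroupOf V).Normal)
    (hp : (V₁.relIndex V).Prime) : IsOpen (V₁ : Set G) :=
  primeIndex_isOpen_of_commutator_isClosed hS
    (fun U hU => isClosed_commutator_of_isClosed_commutator_subtype hU (hA U hU)) V V₁ hV hV₁V hn hp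

end Commutator

end StronglyCompleteSolvableDescent

end Literature.GroupTheory
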